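import Summits.Ventures.Crystal3D.Theorems.StickyWulffConstantPolycrystalWulffBoundArrangementCells

/-!
# `PolycrystalWulffBound`, rung `rung_basalLamellar` — step 2c: where a point of the chimera
# neighbourhood sits in the arrangement (line `PolyDensity`, crux `stmt-Ventures-19482`)

Route `StickyWulffConstant` of the venture `Summits/Ventures/Crystal3D`, second prover lane (poly-p2,
gen 3).  Combinatorial core of the polyhedral anisotropic MINKOWSKI-CONTENT bound («slab accounting»):
cells of the arrangement of a finite constraint set `𝓟` are indexed by sign vectors `T ⊆ 𝓟` (as in
`…ArrangementCells`).  If `x = q + r·k` with `q` in the cell of `T`, `k` in a body `K ⊆ B̄(0, R)`, and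
`x` lies on no plane of `𝓟`, then `x` lies in the cell of its own sign vector `T_x`, and
(`chimera_point_trichotomy`) EITHER `T_x = T`, OR `T_x` differs from `T` in exactly one constraint `p`
and `x` lies in the one-sided slab `β < ⟪n, x⟫ < β + r·h_K(n)` beyond the corresponding facet of the
cell of `T` (`n` its outer normal there, `h_K(n) = sup_{y ∈ K} ⟪y, n⟫`), OR `x` is within `r·R` of two
different constraint planes.
WHAT THIS IS NOT: any measure theory; nothing on the crux.
-/

noncomputable section

open scoped BigOperators InnerProductSpace Classical
open Set

namespace Summit.Ventures.Crystal3D.Theorems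

variable {E : Type*} [NormedAddCommGroup E] [InnerProductSpace ℝ E]

/-- **Trichotomy for a point of the chimera neighbourhood** (sign form; any real inner product
space).  `q` lies in the cell of the sign vector `T ⊆ 𝓟` (strict sign conditions), `x = q + r k` with
`k ∈ K ⊆ B̄(0,R)`, and `x` is on no constraint plane.  Then the sign vector of `x` is `T`, or it is
`T △ {p}` for one constraint `p` with `x` in the one-sided slab of width `r·h_K` beyond `p` (seen from
the cell of `T`), or `x` is within `r R` of two different constraint planes. -/
theorem chimera_point_trichotomy (𝓟 T : Finset (E × ℝ))
    (h1 : ∀ p ∈ 𝓟, ‖p.1‖ = 1) (hT : T ⊆ 𝓟)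
    {q x k : E} {K : Set E} {R r : ℝ}
    (hq : ∀ p ∈ 𝓟, (p ∈ T → ⟪p.1, q⟫_ℝ < p.2) ∧ (p ∉ T → p.2 < ⟪p.1, q⟫_ℝ))
    (hK : K ⊆ Metric.closedBall 0 R) (hk : k ∈ K) (hr : 0 < r) (hx : x = q + r • k)
    (hoff : ∀ p ∈ 𝓟, ⟪p.1, x⟫_ℝ ≠ p.2) :
    𝓟.filter (fun p => ⟪p.1, x⟫_ℝ < p.2) = T ∨
      (∃ p ∈ 𝓟, 𝓟.filter (fun p => ⟪p.1, x⟫_ℝ < p.2) = symmDiff T {p} ∧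
        ((p ∈ T ∧ p.2 < ⟪p.1, x⟫_ℝ ∧ ⟪p.1, x⟫_ℝ < p.2 + r * sSup ((fun y => ⟪y, p.1⟫_ℝ) '' K)) ∨
         (p ∉ T ∧ -p.2 < ⟪-p.1, x⟫_ℝ ∧ ⟪-p.1, x⟫_ℝ < -p.2 + r * sSup ((fun y => ⟪y, -p.1⟫_ℝ) '' K)))) ∨
      (∃ p ∈ 𝓟, ∃ p' ∈ 𝓟, p ≠ p' ∧ |⟪p.1, x⟫_ℝ - p.2| ≤ r * R ∧ |⟪p'.1, x⟫_ℝ - p'.2| ≤ r * R) := by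
  -- norms and the body
  have hkR : ‖k‖ ≤ R := mem_closedBall_zero_iff.1 (hK hk)
  have hKbdd : ∀ v : E, BddAbove ((fun y => ⟪y, v⟫_ℝ) '' K) := by
    intro v
    refine ⟨R * ‖v‖, ?_⟩
    rintro _ ⟨y, hy, rfl⟩
    calc ⟪y, v⟫_ℝ ≤ ‖y‖ * ‖v‖ := real_inner_le_norm _ _
      _ ≤ R * ‖v‖ := by gcongr; exact mem_closedBall_zero_iff.1 (hK hy)
  have hksup : ∀ v : E, ⟪k, v⟫_ℝ ≤ sSup ((fun y => ⟪y, v⟫_ℝ) '' K) :=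
    fun v => le_csSup (hKbdd v) ⟨k, hk, rfl⟩
  -- the set of constraints where the signs of `q` and `x` differ
  set D : Finset (E × ℝ) := 𝓟.filter (fun p => ¬ (p ∈ T ↔ ⟪p.1, x⟫_ℝ < p.2))
    with hD
  -- signs of `x` in terms of `T` and `D`
  have hsign : ∀ p ∈ 𝓟, (p ∈ 𝓟.filter (fun p => ⟪p.1, x⟫_ℝ < p.2) ↔ (p ∈ T ↔ p ∉ D)) := by
    intro p hp
    simp only [hD, Finset.mem_filter, hp, true_and]
    tauto
  -- across a differing constraint, `x` is within `r R` of the plane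
  have hxq : ∀ v : E, ⟪v, x⟫_ℝ = ⟪v, q⟫_ℝ + r * ⟪v, k⟫_ℝ := by
    intro v; rw [hx, inner_add_right, real_inner_smul_right]
  have hpk : ∀ p ∈ 𝓟, |⟪p.1, k⟫_ℝ| ≤ R := fun p hp =>
    (abs_real_inner_le_norm _ _).trans (by rw [h1 p hp, one_mul]; exact hkR)
  have hnear : ∀ p ∈ D, |⟪p.1, x⟫_ℝ - p.2| ≤ r * R := by
    intro p hpD
    obtain ⟨hp, hdiff⟩ := Finset.mem_filter.1 hpD
    obtain ⟨hqT, hqT'⟩ := hq p hp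
    have hne := hoff p hp
    have hk1 := abs_le.1 (hpk p hp)
    have e := hxq p.1
    by_cases hpT : p ∈ T
    · have hq1 : ⟪p.1, q⟫_ℝ < p.2 := hqT hpT
      have hx1 : ¬ ⟪p.1, x⟫_ℝ < p.2 := fun h => hdiff ⟨fun _ => h, fun _ => hpT⟩
      rw [abs_le]; constructor <;> nlinarith [not_lt.1 hx1, hk1.1, hk1.2, hr]
    · have hq1 : p.2 < ⟪p.1, q⟫_ℝ := hqT' hpT
      have hx1 : ⟪p.1, x⟫_ℝ < p.2 := by
        by_contra h
        exact hdiff ⟨fun h' => absurd h' hpT, fun h' => absurd h' h⟩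
      rw [abs_le]; constructor <;> nlinarith [hk1.1, hk1.2, hr]
  -- trichotomy on `D`
  by_cases hD0 : D = ∅
  · -- no differing constraint: `x` is in the cell of `T`
    left
    ext p
    constructor
    · intro hp
      have hp𝓟 : p ∈ 𝓟 := (Finset.mem_filter.1 hp).1
      have := (hsign p hp𝓟).1 hp
      rw [hD0] at this
      simpa using this
    · intro hpT
      have hp𝓟 : p ∈ 𝓟 := hT hpT
      refine (hsign p hp𝓟).2 ?_
      rw [hD0]; simpa using hpT
  · obtain ⟨p, hpD⟩ := Finset.nonempty_iff_ne_empty.2 hD0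
    have hp𝓟 : p ∈ 𝓟 := (Finset.mem_filter.1 hpD).1
    by_cases hD1 : ∀ p' ∈ D, p' = p
    · -- exactly one differing constraint: the adjacent cell across `p`
      right; left
      refine ⟨p, hp𝓟, ?_, ?_⟩
      · ext p''
        rw [Finset.mem_symmDiff, Finset.mem_singleton]
        by_cases hp'' : p'' ∈ 𝓟
        · have hs := hsign p'' hp''
          have hDiff : p'' ∈ D ↔ p'' = p := ⟨fun h => hD1 p'' h, fun h => h ▸ hpD⟩
          rw [hDiff] at hs
          rw [hs]
          tauto
        · have h1' : p'' ∉ 𝓟.filter (fun p => ⟪p.1, x⟫_ℝ < p.2) := fun h => hp'' (Finset.mem_filter.1 h).1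
          have h2' : p'' ∉ T := fun h => hp'' (hT h)
          have h3' : p'' ≠ p := fun h => hp'' (h ▸ hp𝓟)
          tauto
      · obtain ⟨-, hdiff⟩ := Finset.mem_filter.1 hpD
        have hne := hoff p hp𝓟
        obtain ⟨hqT, hqT'⟩ := hq p hp𝓟
        by_cases hpT : p ∈ T
        · left
          have hx1 : ¬ ⟪p.1, x⟫_ℝ < p.2 := fun h => hdiff ⟨fun _ => h, fun _ => hpT⟩
          have hq1 : ⟪p.1, q⟫_ℝ < p.2 := hqT hpT
          have hk1 : ⟪p.1, k⟫_ℝ ≤ sSup ((fun y => ⟪y, p.1⟫_ℝ) '' K) := by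
            rw [real_inner_comm]; exact hksup p.1
          refine ⟨hpT, lt_of_le_of_ne (not_lt.1 hx1) (Ne.symm hne), ?_⟩
          rw [hxq]; nlinarith
        · right
          have hx1 : ⟪p.1, x⟫_ℝ < p.2 := by
            by_contra h
            exact hdiff ⟨fun h' => absurd h' hpT, fun h' => absurd h' h⟩
          have hq1 : ⟪-p.1, q⟫_ℝ < -p.2 := by rw [inner_neg_left]; linarith [hqT' hpT]
          have hk1 : ⟪-p.1, k⟫_ℝ ≤ sSup ((fun y => ⟪y, -p.1⟫_ℝ) '' K) := by
            rw [real_inner_comm]; exact hksup (-p.1)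
          refine ⟨hpT, by rw [inner_neg_left]; linarith, ?_⟩
          rw [hxq]; nlinarith
    · -- two different differing constraints
      right; right
      push Not at hD1
      obtain ⟨p', hp'D, hp'p⟩ := hD1
      exact ⟨p, hp𝓟, p', (Finset.mem_filter.1 hp'D).1, Ne.symm hp'p, hnear p hpD, hnear p' hp'D⟩

end Summit.Ventures.Crystal3D.Theorems

end
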